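import Summits.Ventures.PercRepro0.BoxEvents
import Mathlib.Probability.Independence.InfinitePi
import Mathlib.Probability.Independence.ZeroOne

/-!
# L5 · ZERO-ONE, kernel-checked against `Defs.lean` (seat p5)

Cell pub-perc-repro0, seat p2.  Against `Summit.Ventures.PercRepro0.Defs` (and `BoxEvents.lean`):

* `measurableSet_connInf`, `measurableSet_existsInfCluster`, `measurableSet_atMostOneInfCluster` :
  `{x ↔ ∞}`, `{∃ infinite open cluster}`, `{≤ 1 infinite cluster}` are measurable (F1-type);
* `existsInfCluster_of_agree_off_finite` : changing finitely many bonds neither creates nor destroys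
  infinite clusters (GLUE-p2-v2 L5 Step 1, by induction on the finite set, one bond at a time);
* `iIndepFun_mem` : under `P_p` the bond indicators `ω ↦ (e ∈ ω)` are independent;
* `measure_existsInfCluster_zero_or_one` : `P_p(∃ infinite cluster) ∈ {0,1}` — Kolmogorov's 0–1 law
  (Mathlib's `measure_zero_or_one_of_measurableSet_limsup`, along the cofinite filter on the bonds);
* `measure_existsInfCluster_eq_one_of_thetaI_pos` : `θ_d(p) > 0 ⇒ P_p(∃ infinite cluster) = 1`
  (the form consumed by P1-harris-p1-v1 §0);
* `L5_ZeroOne_of_translation_invariance` : the full `Defs.L5_ZeroOne d`, given F2 in the form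
  `P_p(x ↔ ∞) = P_p(0 ↔ ∞)` for all `x` (p5's FOUNDATIONS F2).
-/

open MeasureTheory ProbabilityTheory unitInterval
open scoped ENNReal Topology

namespace Summit.Ventures.PercRepro0.L2

open Summit.Ventures.PercRepro0.Defs

variable {d : ℕ}

-- BEGIN BODY

/-! ### Measurability of `{x ↔ ∞}` and `{∃ infinite cluster}` -/

/-- `{x ↔ ∞} = ⋂ₙ ⋃_{‖y‖ ≥ n} {x ↔ y}` (an infinite cluster is unbounded, and conversely). -/
lemma connInf_eq_iInter (x : Vertex d) :
    {ω : Config d | ConnInf d ω x} = ⋂ n : ℕ, ⋃ y : Vertex d, ⋃ (_ : n ≤ nrm y), {ω | Conn d ω x y} := by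
  ext ω
  simp only [ConnInf, Set.mem_setOf_eq, Set.mem_iInter, Set.mem_iUnion, exists_prop]
  constructor
  · intro hinf n
    by_contra hcon
    push Not at hcon
    exact hinf ((finite_box n).subset fun y hy => by
      simp only [Set.mem_setOf_eq]
      by_contra hn
      exact hcon y (by omega) hy)
  · intro h hfin
    obtain ⟨m, hm⟩ := (hfin.image nrm).bddAbove
    obtain ⟨y, hy, hc⟩ := h (m + 1)
    have := hm (Set.mem_image_of_mem nrm (show y ∈ cluster d ω x from hc))
    omega

/-- The event `{x ↔ ∞}` is measurable (F1). -/
lemma measurableSet_connInf (x : Vertex d) : MeasurableSet {ω : Config d | ConnInf d ω x} := by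
  rw [connInf_eq_iInter]
  exact MeasurableSet.iInter fun n => MeasurableSet.iUnion fun y =>
    MeasurableSet.iUnion fun _ => measurableSet_conn x y

/-- The event `{∃ infinite open cluster}` is measurable (F1). -/
lemma measurableSet_existsInfCluster : MeasurableSet (existsInfCluster d) := by
  have : existsInfCluster d = ⋃ x : Vertex d, {ω | ConnInf d ω x} := by
    ext ω; simp [existsInfCluster]
  rw [this]
  exact MeasurableSet.iUnion fun x => measurableSet_connInf x

/-- The event `{at most one infinite open cluster}` is measurable (F1; consumed by the block-H twin). -/
lemma measurableSet_atMostOneInfCluster : MeasurableSet (atMostOneInfCluster d) := by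
  have : atMostOneInfCluster d = ⋂ x : Vertex d, ⋂ y : Vertex d,
      ({ω : Config d | ConnInf d ω x}ᶜ ∪ {ω | ConnInf d ω y}ᶜ ∪ {ω | Conn d ω x y}) := by
    ext ω
    simp only [atMostOneInfCluster, Set.mem_setOf_eq, Set.mem_iInter, Set.mem_union, Set.mem_compl_iff]
    constructor
    · intro h x y
      by_cases hx : ConnInf d ω x
      · by_cases hy : ConnInf d ω y
        · exact Or.inr (h x y hx hy)
        · exact Or.inl (Or.inr hy)
      · exact Or.inl (Or.inl hx)
    · intro h x y hx hy
      rcases h x y with (h1 | h2) | h3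
      · exact absurd hx h1
      · exact absurd hy h2
      · exact h3
  rw [this]
  exact MeasurableSet.iInter fun x => MeasurableSet.iInter fun y =>
    ((measurableSet_connInf x).compl.union (measurableSet_connInf y).compl).union
      (measurableSet_conn x y)

/-! ### Finite modifications -/

/-- Opening more bonds only creates connections. -/
lemma conn_mono' {ω ω' : Config d} (h : ω ⊆ ω') {x y : Vertex d} (hc : Conn d ω x y) :
    Conn d ω' x y :=
  hc.mono (SimpleGraph.fromEdgeSet_mono (Set.inter_subset_inter_left _ h))

/-- Opening more bonds only creates infinite clusters. -/
lemma existsInfCluster_mono {ω ω' : Config d} (h : ω ⊆ ω') (hω : ω ∈ existsInfCluster d) :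
    ω' ∈ existsInfCluster d := by
  obtain ⟨x, hx⟩ := hω
  exact ⟨x, hx.mono fun y hy => conn_mono' h hy⟩

/-- Removing one bond `s(u,v)` splits the cluster of `x` into at most three pieces: the new clusters
of `x`, `u` and `v`. -/
lemma cluster_subset_of_remove {ω ω' : Config d} {u v : Vertex d}
    (h : ∀ e', e' ≠ s(u, v) → (e' ∈ ω ↔ e' ∈ ω')) (x : Vertex d) :
    cluster d ω x ⊆ cluster d ω' x ∪ cluster d ω' u ∪ cluster d ω' v := by
  intro y hy
  have hy' : Relation.ReflTransGen (OAdj ω) x y := (conn_iff_reflTransGen ω x y).1 hy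
  clear hy
  simp only [cluster, Set.mem_union, Set.mem_setOf_eq, conn_iff_reflTransGen]
  induction hy' with
  | refl => exact Or.inl (Or.inl Relation.ReflTransGen.refl)
  | @tail y' y _ hadj ih =>
    obtain ⟨hadjl, hmem⟩ := hadj
    by_cases he : s(y', y) = s(u, v)
    · rcases Sym2.eq_iff.1 he with ⟨-, rfl⟩ | ⟨-, rfl⟩
      · exact Or.inr Relation.ReflTransGen.refl
      · exact Or.inl (Or.inr Relation.ReflTransGen.refl)
    · have hmem' : s(y', y) ∈ ω' := (h _ he).1 hmem
      rcases ih with (h1 | h2) | h3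
      · exact Or.inl (Or.inl (h1.tail ⟨hadjl, hmem'⟩))
      · exact Or.inl (Or.inr (h2.tail ⟨hadjl, hmem'⟩))
      · exact Or.inr (h3.tail ⟨hadjl, hmem'⟩)

/-- Toggling one bond neither creates nor destroys infinite clusters. -/
lemma existsInfCluster_of_agree_off_one {ω ω' : Config d} (e : Sym2 (Vertex d))
    (h : ∀ e', e' ≠ e → (e' ∈ ω ↔ e' ∈ ω')) (hω : ω ∈ existsInfCluster d) :
    ω' ∈ existsInfCluster d := by
  by_cases hsub : ω ⊆ ω'
  · exact existsInfCluster_mono hsub hω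
  · -- the only bond of `ω` missing from `ω'` is `e`: `ω'` is `ω` with `e` removed
    induction e using Sym2.ind with
    | h u v =>
      obtain ⟨x, hx⟩ := hω
      have hsplit := cluster_subset_of_remove h x
      have hinf : (cluster d ω' x ∪ cluster d ω' u ∪ cluster d ω' v).Infinite := hx.mono hsplit
      rcases Set.infinite_union.1 hinf with h12 | h3
      · rcases Set.infinite_union.1 h12 with h1 | h2
        · exact ⟨x, h1⟩
        · exact ⟨u, h2⟩
      · exact ⟨v, h3⟩

/-- GLUE L5 Step 1: changing finitely many bonds neither creates nor destroys infinite clusters. -/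
lemma existsInfCluster_of_agree_off_finite {F : Set (Sym2 (Vertex d))} (hF : F.Finite) :
    ∀ ω ω' : Config d, (∀ e ∉ F, (e ∈ ω ↔ e ∈ ω')) → ω ∈ existsInfCluster d →
      ω' ∈ existsInfCluster d := by
  induction F, hF using Set.Finite.induction_on with
  | empty =>
    intro ω ω' h hω
    have : ω = ω' := Set.ext fun e => h e (Set.notMem_empty e)
    rwa [← this]
  | @insert e F' _ _ ih =>
    intro ω ω' h hω
    classical
    -- `ω''` agrees with `ω` at `e` and with `ω'` elsewhere
    let ω'' : Config d := if e ∈ ω then insert e ω' else ω' \ {e}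
    have h1 : ∀ e' ∉ F', (e' ∈ ω ↔ e' ∈ ω'') := by
      intro e' he'
      by_cases hee : e' = e
      · subst hee
        simp only [ω'']
        split_ifs with hmem
        · simp [hmem]
        · simp [hmem]
      · have := h e' (by simp [he', hee])
        simp only [ω'']
        split_ifs <;> simp [hee, this]
    have h2 : ∀ e', e' ≠ e → (e' ∈ ω'' ↔ e' ∈ ω') := by
      intro e' hee
      simp only [ω'']
      split_ifs <;> simp [hee]
    exact existsInfCluster_of_agree_off_one e h2 (ih ω ω'' h1 hω)

/-! ### Independence of the bond indicators and the 0–1 law -/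

/-- The bond indicator `ω ↦ (e ∈ ω)` (Prop-valued) is measurable. -/
lemma measurable_memProp (e : Sym2 (Vertex d)) : Measurable fun ω : Config d => (e ∈ ω) :=
  measurable_set_mem e

/-- Under `P_p`, the bond indicators are independent (the product structure of `setBernoulli`). -/
lemma iIndepFun_mem (p : I) :
    iIndepFun (fun (e : Sym2 (Vertex d)) (ω : Config d) => (e ∈ ω)) (P d p) := by
  rw [iIndepFun_iff_map_fun_eq_infinitePi_map (fun e => measurable_memProp e)]
  unfold P
  rw [setBernoulli_eq_map]
  have hid : (fun (ω : Config d) (e : Sym2 (Vertex d)) => (e ∈ ω)) ∘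
      (fun q : Sym2 (Vertex d) → Prop => {i | q i}) = id := by
    funext q; rfl
  rw [Measure.map_map (measurable_pi_lambda _ fun e => measurable_memProp e) measurable_setOf, hid,
    Measure.map_id]
  congr 1
  funext e
  rw [Measure.map_map (measurable_memProp e) measurable_setOf]
  have : (fun ω : Config d => (e ∈ ω)) ∘ (fun q : Sym2 (Vertex d) → Prop => {i | q i}) =
      Function.eval e := by
    funext q; rfl
  rw [this, Measure.infinitePi_map_eval]

/-- The σ-algebra generated by the bond indicator of `e`. -/
abbrev bondSigma (d : ℕ) (e : Sym2 (Vertex d)) : MeasurableSpace (Config d) :=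
  MeasurableSpace.comap (fun ω : Config d => (e ∈ ω)) ⊤

/-- Each `bondSigma d e` is a sub-σ-algebra of the product σ-algebra. -/
lemma bondSigma_le (e : Sym2 (Vertex d)) : bondSigma d e ≤ (inferInstance : MeasurableSpace (Config d)) :=
  (measurable_memProp e).comap_le

/-- Independence of the bond σ-algebras. -/
lemma iIndep_bondSigma (p : I) : iIndep (bondSigma d) (P d p) :=
  (iIndepFun_iff_iIndep _ _ _).1 (iIndepFun_mem p)

/-- Restriction of a configuration to the bonds of `t` (bonds outside `t` closed). -/
def restrictCfg (t : Set (Sym2 (Vertex d))) (ω : Config d) : Config d := ω ∩ t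

/-- `restrictCfg t` is measurable from the σ-algebra generated by the bonds of `t`. -/
lemma measurable_restrictCfg (t : Set (Sym2 (Vertex d))) :
    Measurable[⨆ e ∈ t, bondSigma d e, inferInstance] (restrictCfg t) := by
  refine (@measurable_set_iff (Sym2 (Vertex d)) (Config d) (⨆ e ∈ t, bondSigma d e)
    (restrictCfg t)).2 fun e => ?_
  by_cases he : e ∈ t
  · have h1 : (fun ω : Config d => e ∈ restrictCfg t ω) = fun ω => (e ∈ ω) := by
      funext ω; simp [restrictCfg, he]
    rw [h1]
    have hm : Measurable[bondSigma d e, ⊤] (fun ω : Config d => (e ∈ ω)) :=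
      Measurable.of_comap_le le_rfl
    exact hm.mono (le_iSup₂ (f := fun e (_ : e ∈ t) => bondSigma d e) e he) le_rfl
  · have h1 : (fun ω : Config d => e ∈ restrictCfg t ω) = fun _ => False := by
      funext ω; simp [restrictCfg, he]
    rw [h1]
    exact measurable_const

/-- `{∃ infinite cluster}` is measurable with respect to the bonds of any cofinite set `t`. -/
lemma measurableSet_existsInfCluster_iSup {t : Set (Sym2 (Vertex d))} (ht : tᶜ.Finite) :
    MeasurableSet[⨆ e ∈ t, bondSigma d e] (existsInfCluster d) := by
  have hpre : existsInfCluster d = restrictCfg t ⁻¹' existsInfCluster d := by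
    ext ω
    constructor
    · intro hω
      exact existsInfCluster_of_agree_off_finite ht ω (restrictCfg t ω)
        (fun e he => by simp [restrictCfg, Set.notMem_compl_iff.1 he]) hω
    · intro hω
      exact existsInfCluster_of_agree_off_finite ht (restrictCfg t ω) ω
        (fun e he => by simp [restrictCfg, Set.notMem_compl_iff.1 he]) hω
  rw [hpre]
  exact measurable_restrictCfg t measurableSet_existsInfCluster

/-- `{∃ infinite cluster}` is a tail event (measurable w.r.t. the limsup of the bond σ-algebras
along the cofinite filter). -/
lemma measurableSet_existsInfCluster_tail :
    MeasurableSet[Filter.limsup (bondSigma d) Filter.cofinite] (existsInfCluster d) := by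
  rw [Filter.limsup_eq_iInf_iSup]
  refine MeasurableSpace.measurableSet_iInf.2 fun t => MeasurableSpace.measurableSet_iInf.2 fun ht => ?_
  exact measurableSet_existsInfCluster_iSup (Filter.mem_cofinite.1 ht)

/-- Kolmogorov's 0–1 law for `{∃ infinite cluster}`: `P_p(∃ infinite cluster) ∈ {0,1}`. -/
theorem measure_existsInfCluster_zero_or_one (p : I) :
    P d p (existsInfCluster d) = 0 ∨ P d p (existsInfCluster d) = 1 := by
  classical
  refine measure_zero_or_one_of_measurableSet_limsup (s := bondSigma d) (f := Filter.cofinite)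
    (p := fun t => t.Finite) (ns := fun F : Finset (Sym2 (Vertex d)) => (↑F : Set (Sym2 (Vertex d))))
    (fun e => bondSigma_le e) (iIndep_bondSigma p) (fun t ht => ht.compl_mem_cofinite) ?_
    (fun F => F.finite_toSet) (fun e => ⟨{e}, by simp⟩) measurableSet_existsInfCluster_tail
  intro F G
  exact ⟨F ∪ G, by simp, by simp⟩

/-- `θ_d(p) > 0 ⇒ P_p(∃ infinite cluster) = 1` (the form P1-harris-p1-v1 consumes). -/
theorem measure_existsInfCluster_eq_one_of_thetaI_pos (p : I) (h : 0 < thetaI d p) :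
    P d p (existsInfCluster d) = 1 := by
  rcases measure_existsInfCluster_zero_or_one (d := d) p with h0 | h1
  · exfalso
    have hsub : percolates d ⊆ existsInfCluster d := fun ω hω => ⟨0, hω⟩
    have : P d p (percolates d) = 0 := measure_mono_null hsub h0
    unfold thetaI at h
    rw [this] at h
    simp at h
  · exact h1

/-- `P_p(∃ infinite cluster) = 1 ⇒ θ_d(p) > 0`, given translation invariance in the form
`P_p(x ↔ ∞) = P_p(0 ↔ ∞)` for every `x` (F2). -/
theorem thetaI_pos_of_measure_existsInfCluster_eq_one (p : I)
    (hF2 : ∀ x : Vertex d, P d p {ω | ConnInf d ω x} = P d p (percolates d))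
    (h1 : P d p (existsInfCluster d) = 1) : 0 < thetaI d p := by
  by_contra hle
  push Not at hle
  have hzero : P d p (percolates d) = 0 := by
    have h0 : thetaI d p = 0 := le_antisymm hle (thetaI_nonneg d p)
    unfold thetaI at h0
    exact (ENNReal.toReal_eq_zero_iff _).1 h0 |>.resolve_right (measure_ne_top _ _)
  have hE : existsInfCluster d = ⋃ x : Vertex d, {ω | ConnInf d ω x} := by
    ext ω; simp [existsInfCluster]
  have : P d p (existsInfCluster d) = 0 := by
    rw [hE]
    exact measure_iUnion_null fun x => by rw [hF2 x, hzero]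
  rw [this] at h1
  exact zero_ne_one h1

/-- L5 · ZERO-ONE (Lean twin of `Defs.L5_ZeroOne d`), given F2 for all `p`. -/
theorem L5_ZeroOne_of_translation_invariance
    (hF2 : ∀ (p : I) (x : Vertex d), P d p {ω | ConnInf d ω x} = P d p (percolates d)) :
    L5_ZeroOne d := by
  intro p
  refine ⟨measure_existsInfCluster_zero_or_one p, ?_⟩
  exact ⟨thetaI_pos_of_measure_existsInfCluster_eq_one p (hF2 p),
    measure_existsInfCluster_eq_one_of_thetaI_pos p⟩

-- END BODY

end Summit.Ventures.PercRepro0.L2
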